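import Literature.Geometry.Lorentzian.KerrConeModeSupBound
import Literature.Geometry.Lorentzian.TeukolskyFarEnvelope
import Literature.Geometry.Lorentzian.CarterHorizonPocket
import Literature.Geometry.Lorentzian.KerrTortoiseRadiusSurj
import Literature.Geometry.Lorentzian.TeukolskyHorizonSupPorts
import Literature.Geometry.Lorentzian.CarterConeArithmetic
import Literature.Analysis.ODE.TransitionZoneGrowth
import HarnessLib

/-!
# A global envelope of the infinity-normalised scalar radial solution `R_𝓘` at bounded
# OFF-cone frequencies with `m ≠ 0`, UNIFORM in the Kerr parameter up to extremality

(namespace `Literature.Geometry.Lorentzian.Kerr`.) ZONE LEMMAS for the theorem assembled in the companion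
`TeukolskyOffConeSupBoundsBox.lean` (`Kerr.offCone_infinityEnvelope`): for `0 < M`, a cone aperture
`ε₀ > 0` and a frequency window `0 < ω_l ≤ |ω| ≤ ω_h`, `Λ ≤ Λ_h`, there are `a₁ < M` and ONE constant `P`
such that for every `a₁ ≤ |a| < M`, every admissible triple `(ω, m, Λ)` in the window with `m ≠ 0` which is
OFF the threshold cone (`ε₀|m| < |ω − mω₊|`; superradiant or not), and every pair
`(R_𝓗, R_𝓘)` of classical radial solutions (`λ = Λ − a²ω²`) normalised at `𝓗⁺` resp. `𝓘⁺` (TdC Def. 2.3):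
`(r² + a²)^{1/2}|R_𝓘(r)| ≤ P` for ALL `r > r₊` — the input `OffConeSupBounds` of the near-extremal
integrated-decay programme (crux `KappaExplicitWaveDecay`, DRSR Prop. 9.7.1 off the cone), with NO loss in
`κ`. Here: the conjugate-basis transfer `norm_le_of_conjBasis`, the `r*`-length of a radial interval
`tortoise_length_le` / `middleZone_length_le`, and the far / coefficient / pocket bounds in the tortoise
variable (`farEnvelope_tortoise`, `abs_omega_sq_sub_sepPotential_le`, `horizonPocket_tortoise`).

The three zones (tortoise variable `u_𝓘 = (r² + a²)^{1/2}R_𝓘 ∘ R(r*)`):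
* far, `r ≥ R_F = max(7M, √(12Λ₁)/ω_l, 1/(Mω_l²))` (`Λ₁ = max Λ_h 2`): `|u_𝓘| ≤ 2`, `|u_𝓘′| ≤ √2|ω|`
  (`Costa2019.farEnvelope`, κ-free);
* middle, `r₊ + ℓ ≤ r ≤ R_F` with `ℓ = c₁|σ|(r₊² + a²) ≥ ℓ₀ = c₁ε₀M²` (`σ = ω − mω₊`, `|σ| > ε₀|m| ≥ ε₀`
  off the cone): the `r*`-length of this zone is `≤ L₀ = R_F(R_F² + M²)/ℓ₀²` (mean value theorem,
  `dR/dr* = Δ/(r² + a²) ≥ Δ(r₊ + ℓ)/(R_F² + a²) ≥ ℓ²/(R_F² + M²)`; `tortoise_length_le`), UNIFORMLY in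
  `κ`, and `|ω² − V| ≤ K² = ω_h² + 3Λ₁/M² + 3/M²` (`Kerr.abs_sepPotential_le`), so the transition-zone
  growth bound (`Literature.Analysis.ODE.norm_le_of_norm_coeff_le_sq`) transports `(u_𝓘, u_𝓘′)` from `R_F`
  inward;
* horizon side, `r ≤ r₊ + ℓ`: `u_𝓘 = αu_𝓗 + βū_𝓗` with `|α| + |β| ≤ (|u_𝓘||u_𝓗′| + |u_𝓘′||u_𝓗|)/|σ|` at
  `r₊ + ℓ` (`ū_𝓗` solves the same real equation; `W(u_𝓗, ū_𝓗) = 2iσ` by the horizon flux;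
  `norm_le_of_conjBasis`), and the `|ξ| ≥ 1` pocket `Kerr.horizonPocket_weightedNormSq_le` bounds
  `|u_𝓗| ≤ 49ρ₀⁴`, `|u_𝓗′| ≤ √3|σ|ρ₀⁴` there (`ρ₀ = (ω_h² + 6Λ₁/M²)·800/ε₀²`; needs `2κ ≤ ε₀`, i.e.
  `2√(M² − a²) ≤ ε₀M²`, which fixes `a₁`, and `m ≠ 0` ⇒ `Λ ≥ 2`; the axisymmetric window `m = 0`, where
  `Λ < 1` may occur, would need the pocket lemma without its cosmetic hypothesis `Λ ≥ 1`).
No envelope of `u_𝓗` beyond the pocket and no Wronskian LOWER bound are used. Everything is proved.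

## References
* M. Dafermos, I. Rodnianski, Y. Shlapentokh-Rothman, arXiv:1402.7034, §8, Prop. 9.7.1.
  [DafermosRodnianskiShlapentokhrothman2014]
* R. Teixeira da Costa, CMP 378 (2020), Def. 2.3, Prop. 2.20. [Costa2019]
-/

noncomputable section

open Complex Set Filter Topology
open scoped ComplexConjugate

namespace Literature.Geometry.Lorentzian.Kerr

/-! ### A second solution from the conjugate basis of the first -/

/-- **Envelope transfer through the conjugate basis.** Let `y`, `w` be global classical solutions of
the REAL equation `z″ = −φz` and suppose the flux of `y` at `x₀` is `Im(ȳ y′)(x₀) = −σ ≠ 0`. Then `ȳ`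
solves the same equation, the three Wronskians `W(y, ȳ) (= 2iσ at x₀)`, `W(w, ȳ)`, `W(y, w)` are
constant, and the pointwise identity `w·W(y, ȳ) = W(w, ȳ)·y + W(y, w)·ȳ` gives
`‖w x‖ ≤ ((‖w x₀‖‖y′ x₀‖ + ‖w′ x₀‖‖y x₀‖)/|σ|)·‖y x‖` at EVERY `x` (no continuity of `φ` needed).
[folklore] -/
theorem norm_le_of_conjBasis {φ : ℝ → ℝ} {y y' w w' : ℝ → ℂ}
    (hy : ∀ x, HasDerivAt y (y' x) x ∧ HasDerivAt y' (-((φ x : ℂ) * y x)) x)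
    (hw : ∀ x, HasDerivAt w (w' x) x ∧ HasDerivAt w' (-((φ x : ℂ) * w x)) x) {x₀ σ : ℝ}
    (hflux : (conj (y x₀) * y' x₀).im = -σ) (hσ : σ ≠ 0) (x : ℝ) :
    ‖w x‖ ≤ (‖w x₀‖ * ‖y' x₀‖ + ‖w' x₀‖ * ‖y x₀‖) / |σ| * ‖y x‖ := by
  -- the conjugate solution
  have hz : ∀ x, HasDerivAt (fun t ↦ conj (y t)) (conj (y' x)) x ∧
      HasDerivAt (fun t ↦ conj (y' t)) (-((φ x : ℂ) * conj (y x))) x := fun x ↦ by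
    refine ⟨(hy x).1.star, ?_⟩
    have h := (hy x).2.star
    have e : star (-((φ x : ℂ) * y x)) = -((φ x : ℂ) * conj (y x)) := by
      rw [star_neg, star_mul', Complex.star_def, Complex.conj_ofReal]
    rwa [e] at h
  -- constancy of Wronskians of global solutions
  have hconst : ∀ {f f' g g' : ℝ → ℂ},
      (∀ x, HasDerivAt f (f' x) x ∧ HasDerivAt f' (-((φ x : ℂ) * f x)) x) →
      (∀ x, HasDerivAt g (g' x) x ∧ HasDerivAt g' (-((φ x : ℂ) * g x)) x) →
      ∀ s t, f s * g' s - f' s * g s = f t * g' t - f' t * g t := by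
    intro f f' g g' hf hg
    have hd : ∀ t, HasDerivAt (fun s ↦ f s * g' s - f' s * g s) 0 t := fun t ↦ by
      refine (((hf t).1.mul (hg t).2).sub ((hf t).2.mul (hg t).1)).congr_deriv ?_
      ring
    exact is_const_of_deriv_eq_zero (fun t ↦ (hd t).differentiableAt) fun t ↦ (hd t).deriv
  -- the pointwise identity, with the Wronskians moved to `x₀`
  have hid : w x * (y x * conj (y' x) - y' x * conj (y x)) =
      (w x * conj (y' x) - w' x * conj (y x)) * y x + (y x * w' x - y' x * w x) * conj (y x) := by
    ring
  rw [hconst hy hz x x₀, hconst hw hz x x₀, hconst hy hw x x₀] at hid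
  -- `W(y, ȳ)(x₀) = conj A − A`, `A = ȳ y′`, of norm `2|σ|`
  set A : ℂ := conj (y x₀) * y' x₀ with hA
  have hWyz : y x₀ * conj (y' x₀) - y' x₀ * conj (y x₀) = ((-(2 * A.im) : ℝ) : ℂ) * I := by
    have e : y x₀ * conj (y' x₀) - y' x₀ * conj (y x₀) = conj A - A := by
      simp only [hA, map_mul, Complex.conj_conj]; ring
    rw [e]
    apply Complex.ext
    · simp
    · simp; ring
  have hnorm : ‖y x₀ * conj (y' x₀) - y' x₀ * conj (y x₀)‖ = 2 * |σ| := by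
    rw [hWyz, norm_mul, Complex.norm_I, mul_one, Complex.norm_real, Real.norm_eq_abs, hflux,
      abs_neg, abs_mul, abs_two, abs_neg]
  -- norms
  have hσ0 : 0 < |σ| := abs_pos.2 hσ
  set S : ℝ := ‖w x₀‖ * ‖y' x₀‖ + ‖w' x₀‖ * ‖y x₀‖ with hS
  have h1 : ‖w x₀ * conj (y' x₀) - w' x₀ * conj (y x₀)‖ ≤ S := by
    refine (norm_sub_le _ _).trans ?_
    rw [norm_mul, norm_mul, Complex.norm_conj, Complex.norm_conj]
  have h2 : ‖y x₀ * w' x₀ - y' x₀ * w x₀‖ ≤ S := by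
    refine (norm_sub_le _ _).trans ?_
    rw [norm_mul, norm_mul, hS]
    linarith [mul_comm ‖y x₀‖ ‖w' x₀‖, mul_comm ‖y' x₀‖ ‖w x₀‖]
  have key : ‖w x‖ * (2 * |σ|) ≤ 2 * S * ‖y x‖ := by
    have h := congrArg (fun z : ℂ ↦ ‖z‖) hid
    simp only [norm_mul] at h
    rw [hnorm] at h
    rw [h]
    refine (norm_add_le _ _).trans ?_
    rw [norm_mul, norm_mul, Complex.norm_conj]
    nlinarith [norm_nonneg (y x)]
  rw [div_mul_eq_mul_div, le_div_iff₀ hσ0]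
  nlinarith [norm_nonneg (w x)]

/-! ### The `r*`-length of a radial interval along a tortoise radius function -/

/-- **`r*`-length of `[R x₀, R x₁]`.** For a tortoise radius function `R` on sub-extremal Kerr and
`x₀ ≤ x₁`: `Δ(R x₀)/(R(x₁)² + a²) · (x₁ − x₀) ≤ R x₁ − R x₀` (mean value theorem: `dR/dx = Δ(R)/(R² + a²)`
is bounded below on `[x₀, x₁]` by its value with `Δ` at the left end and `R² + a²` at the right end, both
being monotone in `r ≥ r₊ ≥ M`). [cite: DafermosRodnianskiShlapentokhrothman2014, §2.1.2] -/
theorem tortoise_length_le {M a : ℝ} {R : ℝ → ℝ} (hR : IsTortoiseRadius M a R)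
    (hMa : IsSubextremal M a) {x₀ x₁ : ℝ} (hx : x₀ ≤ x₁) :
    delta M a (R x₀) / (R x₁ ^ 2 + a ^ 2) * (x₁ - x₀) ≤ R x₁ - R x₀ := by
  rcases hx.eq_or_lt with rfl | hlt
  · simp
  have hmono := (hR.strictMono hMa).monotone
  obtain ⟨c, hc, hc'⟩ := exists_hasDerivAt_eq_slope R (fun x ↦ delta M a (R x) / (R x ^ 2 + a ^ 2))
    hlt hR.continuous.continuousOn fun x _ ↦ hR.hasDerivAt x
  have hA₁ : 0 < R x₁ ^ 2 + a ^ 2 := hR.sq_add_sq_pos hMa x₁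
  have hAc : 0 < R c ^ 2 + a ^ 2 := hR.sq_add_sq_pos hMa c
  have hR0 : ∀ x, 0 < R x := fun x ↦ hR.pos hMa x
  have hMR : ∀ x, M ≤ R x := fun x ↦ (M_le_rPlus M a).trans (hR.rPlus_lt x).le
  -- `Δ(R x₀) ≤ Δ(R c)` and `R c² + a² ≤ R x₁² + a²`
  have hΔ : delta M a (R x₀) ≤ delta M a (R c) := by
    have h1 : R x₀ ≤ R c := hmono hc.1.le
    have h2 : M ≤ R x₀ := hMR x₀
    unfold delta
    nlinarith
  have hA : R c ^ 2 + a ^ 2 ≤ R x₁ ^ 2 + a ^ 2 := by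
    have h1 : R c ≤ R x₁ := hmono hc.2.le
    nlinarith [hR0 c]
  have hΔ0 : 0 ≤ delta M a (R x₀) := (hR.delta_pos hMa x₀).le
  have hslope : delta M a (R x₀) / (R x₁ ^ 2 + a ^ 2) ≤ (R x₁ - R x₀) / (x₁ - x₀) := by
    rw [← hc']
    exact div_le_div₀ ((hR.delta_pos hMa c).le) hΔ hAc hA
  rwa [le_div_iff₀ (sub_pos.2 hlt)] at hslope

/-! ### Zone lemmas in the tortoise variable -/

/-- **Far zone in the tortoise variable.** For `R_𝓘` normalised at `𝓘⁺` and a tortoise radius function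
`ρ`, at every `z` with `ρ z ≥ max(7M, √(12Λ)/|ω|, 1/(Mω²))`: `(ρ(z)² + a²)^{1/2}|R_𝓘(ρ z)| ≤ 2` and the
tortoise derivative `u_𝓘′(z) = (Δ/(r² + a²))·d/dr[(r² + a²)^{1/2}R_𝓘](ρ z)` has `|u_𝓘′(z)| ≤ √2|ω|`
(`Costa2019.farEnvelope`). [cite: DafermosRodnianskiShlapentokhrothman2014, Prop. 8.4.1 (proof)] -/
theorem farEnvelope_tortoise {M a ω Λ : ℝ} {m : ℤ} (hM : 0 < M) (ha : |a| < M) (hω : ω ≠ 0)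
    (hadm : IsAdmissibleTriple a ω m Λ) {RI : ℝ → ℂ}
    (hRI : IsRadialTeukolskySolution M a 0 ω m (Λ - a ^ 2 * ω ^ 2) RI)
    (hnI : IsNormalisedInfinitySolution M 0 ω RI) {ρ : ℝ → ℝ} (hρ : IsTortoiseRadius M a ρ)
    {uI₁ : ℝ → ℂ} (huI₁ : ∀ z, uI₁ z = ((delta M a (ρ z) / (ρ z ^ 2 + a ^ 2) : ℝ) : ℂ) *
      deriv (fun s : ℝ ↦ ((Real.sqrt (s ^ 2 + a ^ 2) : ℝ) : ℂ) * RI s) (ρ z)) {z : ℝ}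
    (hz : max (7 * M) (max (Real.sqrt (12 * Λ) / |ω|) (1 / (M * ω ^ 2))) ≤ ρ z) :
    Real.sqrt (ρ z ^ 2 + a ^ 2) * ‖RI (ρ z)‖ ≤ 2 ∧ ‖uI₁ z‖ ≤ Real.sqrt 2 * |ω| := by
  have hMa : IsSubextremal M a := ha
  obtain ⟨h1, h2⟩ := Costa2019.farEnvelope hM ha hω hadm hRI hnI hz
  constructor
  · have h3 : (Real.sqrt (ρ z ^ 2 + a ^ 2) * ‖RI (ρ z)‖) ^ 2 ≤ 2 ^ 2 := by
      rw [mul_pow, Real.sq_sqrt (hρ.sq_add_sq_pos hMa z).le]; linarith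
    exact (pow_le_pow_iff_left₀ (by positivity) (by norm_num) two_ne_zero).1 h3
  · rw [huI₁ z, norm_mul, Complex.norm_real, Real.norm_eq_abs, abs_of_pos (hρ.deriv_pos hMa z)]
    have h3 : (delta M a (ρ z) / (ρ z ^ 2 + a ^ 2) *
        ‖deriv (fun s : ℝ ↦ ((Real.sqrt (s ^ 2 + a ^ 2) : ℝ) : ℂ) * RI s) (ρ z)‖) ^ 2 ≤
        (Real.sqrt 2 * |ω|) ^ 2 := by
      rw [mul_pow, mul_pow, Real.sq_sqrt (by norm_num : (0:ℝ) ≤ 2), sq_abs]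
      exact h2
    have hΔ : 0 ≤ delta M a (ρ z) / (ρ z ^ 2 + a ^ 2) := (hρ.deriv_pos hMa z).le
    exact (pow_le_pow_iff_left₀ (by positivity) (by positivity) two_ne_zero).1 h3

/-- **The coefficient of Carter's equation is bounded on a frequency box**: for `0 < M`, `|a| ≤ M`, an
admissible triple with `|ω| ≤ ω_h′`, `Λ ≤ Λ₁` and `r ≥ r₊` (`≥ M`):
`|ω² − V(r)| ≤ ω_h′² + 3Λ₁/M² + 3/M²` (`Kerr.abs_sepPotential_le`: `|V| ≤ 3Λ/r² + 3M/r³`).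
[cite: DafermosRodnianskiShlapentokhrothman2014, §8.4] -/
theorem abs_omega_sq_sub_sepPotential_le {M a ω Λ ωh' Λ₁ r : ℝ} {m : ℤ} (hM : 0 < M) (haM : |a| ≤ M)
    (hadm : IsAdmissibleTriple a ω m Λ) (hω : |ω| ≤ ωh') (hΛ : Λ ≤ Λ₁) (hr : rPlus M a ≤ r) :
    |ω ^ 2 - sepPotential M a ω m Λ r| ≤ ωh' ^ 2 + 3 * Λ₁ / M ^ 2 + 3 / M ^ 2 := by
  have hV := abs_sepPotential_le hM haM hadm hr
  have hMr : M ≤ r := (M_le_rPlus M a).trans hr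
  have hΛ0 : 0 ≤ Λ := hadm.nonneg
  have hr0 : 0 < r := hM.trans_le hMr
  have h1 : 3 * Λ / r ^ 2 ≤ 3 * Λ₁ / M ^ 2 :=
    div_le_div₀ (by nlinarith) (by linarith) (by positivity) (by nlinarith)
  have h2 : 3 * M / r ^ 3 ≤ 3 / M ^ 2 := by
    rw [div_le_div_iff₀ (by positivity) (by positivity)]
    have : M ^ 3 ≤ r ^ 3 := pow_le_pow_left₀ hM.le hMr 3
    nlinarith
  have hω2 : ω ^ 2 ≤ ωh' ^ 2 := by
    rw [← sq_abs ω]; exact pow_le_pow_left₀ (abs_nonneg ω) hω 2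
  calc |ω ^ 2 - sepPotential M a ω m Λ r| ≤ |ω ^ 2| + |sepPotential M a ω m Λ r| := abs_sub _ _
    _ ≤ ωh' ^ 2 + (3 * Λ₁ / M ^ 2 + 3 / M ^ 2) := by
        rw [abs_of_nonneg (sq_nonneg ω)]; exact add_le_add hω2 (hV.trans (add_le_add h1 h2))
    _ = _ := by ring

/-- **The `|ξ| ≥ 1` pocket in the tortoise variable, box form.** Under the hypotheses of
`Kerr.horizonPocket_weightedNormSq_le` (pocket parameter `c₁`, `r₊ − r₋ ≤ |σ|(r₊² + a²)`, `Λ ≥ 1`), if the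
pocket ratio `(ω² + 6Λ/M²)/(σ²/800)` is `≤ ρ₀` and `|σ| ≤ σ₁`, then at every `z` with
`ρ z − r₊ ≤ c₁|σ|(r₊² + a²)` and `ρ z − r₊ ≤ M`: `(ρ(z)² + a²)^{1/2}|R_𝓗(ρ z)| ≤ 49ρ₀⁴` and the tortoise
derivative satisfies `|u_𝓗′(z)| ≤ √3σ₁ρ₀⁴` (`√2400 < 49`). [cite: DafermosRodnianskiShlapentokhrothman2014, §8] -/
theorem horizonPocket_tortoise {M a ω Λ c₁ ρ₀ σ₁ : ℝ} {m : ℤ} (hM : 0 < M) (ha : |a| < M)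
    (hadm : IsAdmissibleTriple a ω m Λ) (hΛ : 1 ≤ Λ) (hc₀ : 0 < c₁) (hc₁ : c₁ ≤ 1)
    (hcω : 10 * M * |ω| * c₁ ≤ 1) (hcΛ : 16 * (2 * Λ + 3) * c₁ ≤ 1)
    (hσ : rPlus M a - rMinus M a ≤ |ω - m * horizonAngularVelocity M a| * (rPlus M a ^ 2 + a ^ 2))
    {RH : ℝ → ℂ} (hRH : IsRadialTeukolskySolution M a 0 ω m (Λ - a ^ 2 * ω ^ 2) RH)
    (hnH : IsNormalisedHorizonSolution M a 0 ω m RH) {ρ : ℝ → ℝ} (hρ : IsTortoiseRadius M a ρ)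
    {uH₁ : ℝ → ℂ} (huH₁ : ∀ z, uH₁ z = ((delta M a (ρ z) / (ρ z ^ 2 + a ^ 2) : ℝ) : ℂ) *
      deriv (fun s : ℝ ↦ ((Real.sqrt (s ^ 2 + a ^ 2) : ℝ) : ℂ) * RH s) (ρ z))
    (hratio : (ω ^ 2 + 6 * Λ / M ^ 2) / ((ω - m * horizonAngularVelocity M a) ^ 2 / 800) ≤ ρ₀)
    (hσσ₁ : |ω - m * horizonAngularVelocity M a| ≤ σ₁) {z : ℝ}
    (hz : ρ z - rPlus M a ≤ c₁ * |ω - m * horizonAngularVelocity M a| * (rPlus M a ^ 2 + a ^ 2))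
    (hzM : ρ z - rPlus M a ≤ M) :
    Real.sqrt (ρ z ^ 2 + a ^ 2) * ‖RH (ρ z)‖ ≤ 49 * ρ₀ ^ 4 ∧ ‖uH₁ z‖ ≤ Real.sqrt 3 * σ₁ * ρ₀ ^ 4 := by
  have hMa : IsSubextremal M a := ha
  have h := horizonPocket_weightedNormSq_le hM ha hadm hΛ hc₀ hc₁ hcω hcΛ hσ hRH hnH (hρ.rPlus_lt z)
    hz hzM
  have hratio0 : 0 ≤ (ω ^ 2 + 6 * Λ / M ^ 2) / ((ω - m * horizonAngularVelocity M a) ^ 2 / 800) := by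
    have : 0 ≤ Λ := by linarith
    positivity
  have hρ₀0 : 0 ≤ ρ₀ := hratio0.trans hratio
  have h8 := pow_le_pow_left₀ hratio0 hratio 8
  constructor
  · have h1 : (Real.sqrt (ρ z ^ 2 + a ^ 2) * ‖RH (ρ z)‖) ^ 2 ≤ (49 * ρ₀ ^ 4) ^ 2 := by
      calc _ ≤ _ := h.1
        _ ≤ 2400 * ρ₀ ^ 8 := by gcongr
        _ ≤ (49 * ρ₀ ^ 4) ^ 2 := by nlinarith [pow_nonneg hρ₀0 8]
    exact (pow_le_pow_iff_left₀ (by positivity) (by positivity) two_ne_zero).1 h1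
  · rw [huH₁ z, norm_mul, Complex.norm_real, Real.norm_eq_abs, abs_of_pos (hρ.deriv_pos hMa z)]
    have hσ0 : 0 ≤ σ₁ := (abs_nonneg _).trans hσσ₁
    have h1 : (delta M a (ρ z) / (ρ z ^ 2 + a ^ 2) *
        ‖deriv (fun s : ℝ ↦ ((Real.sqrt (s ^ 2 + a ^ 2) : ℝ) : ℂ) * RH s) (ρ z)‖) ^ 2 ≤
        (Real.sqrt 3 * σ₁ * ρ₀ ^ 4) ^ 2 := by
      calc _ ≤ _ := h.2
        _ ≤ 3 * σ₁ ^ 2 * ρ₀ ^ 8 := by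
            have hσ2 : (ω - m * horizonAngularVelocity M a) ^ 2 ≤ σ₁ ^ 2 := by
              rw [← sq_abs]; exact pow_le_pow_left₀ (abs_nonneg _) hσσ₁ 2
            exact mul_le_mul (by nlinarith) h8 (by positivity) (by positivity)
        _ = (Real.sqrt 3 * σ₁ * ρ₀ ^ 4) ^ 2 := by
            rw [mul_pow, mul_pow, Real.sq_sqrt (by norm_num : (0 : ℝ) ≤ 3)]; ring
    have hΔ : 0 ≤ delta M a (ρ z) / (ρ z ^ 2 + a ^ 2) := (hρ.deriv_pos hMa z).le
    exact (pow_le_pow_iff_left₀ (by positivity) (by positivity) two_ne_zero).1 h1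

/-- **`r*`-length of the middle zone `[r₊ + ℓ, R_F]`**: along a tortoise radius function on sub-extremal
Kerr, if `ρ x₀ = r₊ + ℓ`, `ρ x_F = R_F`, `x₀ < x_F`, `0 < ℓ₀ ≤ ℓ` and `0 < R_F`, then
`x_F − x₀ ≤ R_F(R_F² + M²)/ℓ₀²` — UNIFORMLY in `κ` (`Δ(r₊ + ℓ) = ℓ(ℓ + r₊ − r₋) ≥ ℓ₀²`, `a² ≤ M²`;
`tortoise_length_le`). [cite: DafermosRodnianskiShlapentokhrothman2014, §2.1.2] -/
theorem middleZone_length_le {M a ℓ ℓ₀ RF : ℝ} {ρ : ℝ → ℝ} (hM : 0 < M) (hMa : IsSubextremal M a)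
    (hρ : IsTortoiseRadius M a ρ) (hℓ₀0 : 0 < ℓ₀) (hℓℓ₀ : ℓ₀ ≤ ℓ) (hRF : 0 < RF) {x₀ xF : ℝ}
    (hx₀ : ρ x₀ = rPlus M a + ℓ) (hxF : ρ xF = RF) (hx₀F : x₀ < xF) :
    xF - x₀ ≤ RF * (RF ^ 2 + M ^ 2) / ℓ₀ ^ 2 := by
  have ha : |a| < M := hMa
  have h := tortoise_length_le hρ hMa hx₀F.le
  rw [hx₀, hxF] at h
  have hΔ : ℓ₀ ^ 2 ≤ delta M a (rPlus M a + ℓ) := by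
    rw [delta_eq_mul ha.le]
    have hd : 0 ≤ rPlus M a - rMinus M a := by linarith [IsSubextremal.rMinus_lt_rPlus hMa]
    calc ℓ₀ ^ 2 ≤ ℓ ^ 2 := pow_le_pow_left₀ hℓ₀0.le hℓℓ₀ 2
      _ ≤ (rPlus M a + ℓ - rPlus M a) * (rPlus M a + ℓ - rMinus M a) := by nlinarith
  have hA : RF ^ 2 + a ^ 2 ≤ RF ^ 2 + M ^ 2 := by nlinarith [sq_abs a, abs_nonneg a]
  have hAF : 0 < RF ^ 2 + a ^ 2 := by positivity
  have h1 : ℓ₀ ^ 2 / (RF ^ 2 + M ^ 2) * (xF - x₀) ≤ RF := by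
    calc ℓ₀ ^ 2 / (RF ^ 2 + M ^ 2) * (xF - x₀)
        ≤ delta M a (rPlus M a + ℓ) / (RF ^ 2 + a ^ 2) * (xF - x₀) := by
          refine mul_le_mul_of_nonneg_right (div_le_div₀ ?_ hΔ hAF hA) (by linarith)
          exact (sq_nonneg ℓ₀).trans hΔ
      _ ≤ RF - (rPlus M a + ℓ) := h
      _ ≤ RF := by linarith [rPlus_pos hM a, hℓ₀0.trans_le hℓℓ₀]
  rw [le_div_iff₀ (by positivity)]
  rw [div_mul_eq_mul_div, div_le_iff₀ (by positivity)] at h1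
  nlinarith

end Literature.Geometry.Lorentzian.Kerr

end
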